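import Summits.Ventures.PercRepro.C041TriDomCycleHost

/-!
# ROW C-041 — THEOREM (CYCLES): CONJECTURE (STOCHASTIC DOMINATION) HOLDS ON EVERY CYCLE HOST
(p6, gen 45; P6-TWOEXIT-LEAN.md §53 ADDENDUM 16)

Marks `0 < p < q` on the cycle `cycleHost m`, arcs `a = [0, p)`, `b = [p, q)`, `c = [q, m + 1)`.  By THE ARC
LEMMA the crossed classes are (`cycCrossed_cycle_iff`) «`a` red, `c` blue, `b` mixed» (`arcA`), «`c` red, `b`
blue, `a` mixed» (`arcB`), «`b` red, `a` blue, `c` mixed» (`arcC`), and `(⊤, ⊥)` is «two arcs red, the third not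
all blue» (`topBot_cycle_iff`).  **THE ARC FLIP** (`cycleFlip`): turn the all-blue arc red.  It is red-ward, lands
in `(⊤, ⊥)`, and is injective: within a class because the flipped arc was all blue, across classes because the
image keeps a different arc mixed.  Hence `CycDomination (cycleHost m) 0 p q` (`cycDomination_cycle`) — the
first NON-SEPARABLE hosts on which the conjecture is a kernel theorem (the subdivided cycles are the first hosts
with all three crossed classes non-empty).
-/

namespace PercRepro

namespace ZoneZ

namespace MultiExit

open ZoneData Finset

variable {m : ℕ} (p q : Fin (m + 1))

/-! ## Arcs -/

/-- A monochromatic range splits at an intermediate point. -/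
theorem mono_split (c : Bool) (ω : Fin (m + 1) → Bool) {lo mid hi : ℕ} (h1 : lo ≤ mid) (h2 : mid ≤ hi) :
    Mono c lo hi ω ↔ Mono c lo mid ω ∧ Mono c mid hi ω := by
  constructor
  · intro h
    exact ⟨fun i hi1 hi2 => h i hi1 (by omega), fun i hi1 hi2 => h i (by omega) hi2⟩
  · rintro ⟨ha, hb⟩ i hi1 hi2
    by_cases hm : i.val < mid
    · exact ha i hi1 hm
    · exact hb i (by omega) hi2

/-- The empty range is monochromatic. -/
theorem mono_empty (c : Bool) (ω : Fin (m + 1) → Bool) (lo : ℕ) : Mono c lo lo ω := fun _ h1 h2 => by omega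

/-- A non-empty range is not monochromatic in both colours. -/
theorem not_mono_both (ω : Fin (m + 1) → Bool) {lo hi : ℕ} (h1 : lo < hi) (h2 : hi ≤ m + 1)
    (hr : Mono true lo hi ω) (hb : Mono false lo hi ω) : False := by
  have h := hr ⟨lo, by omega⟩ (le_refl _) h1
  have h' := hb ⟨lo, by omega⟩ (le_refl _) h1
  rw [h] at h'
  exact Bool.noConfusion h'

variable (hp : 0 < p.val) (hpq : p.val < q.val)

/-- The crossed class with the arc `b` mixed: `a` red, `c` blue. -/
def arcA (ω : Fin (m + 1) → Bool) : Prop :=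
  Mono true 0 p.val ω ∧ Mono false q.val (m + 1) ω ∧ ¬ Mono true p.val q.val ω ∧ ¬ Mono false p.val q.val ω

/-- The crossed class with the arc `a` mixed: `c` red, `b` blue. -/
def arcB (ω : Fin (m + 1) → Bool) : Prop :=
  Mono true q.val (m + 1) ω ∧ Mono false p.val q.val ω ∧ ¬ Mono true 0 p.val ω ∧ ¬ Mono false 0 p.val ω

/-- The crossed class with the arc `c` mixed: `b` red, `a` blue. -/
def arcC (ω : Fin (m + 1) → Bool) : Prop :=
  Mono true p.val q.val ω ∧ Mono false 0 p.val ω ∧ ¬ Mono true q.val (m + 1) ω ∧ ¬ Mono false q.val (m + 1) ω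

/-- `(⊤, ⊥)` on the cycle: two arcs red, the third not all blue. -/
def topArcs (ω : Fin (m + 1) → Bool) : Prop :=
  (Mono true 0 p.val ω ∧ Mono true p.val q.val ω ∧ ¬ Mono false q.val (m + 1) ω) ∨
    (Mono true 0 p.val ω ∧ Mono true q.val (m + 1) ω ∧ ¬ Mono false p.val q.val ω) ∨
    (Mono true p.val q.val ω ∧ Mono true q.val (m + 1) ω ∧ ¬ Mono false 0 p.val ω)

include hp hpq in
/-- The six connectivities of the marks on the cycle, in the arcs. -/
theorem cycle_atoms (ω : Fin (m + 1) → Bool) :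
    (RdS (cycleHost m) (fun _ => EStat.free) ω 0 p ↔
        Mono true 0 p.val ω ∨ (Mono true p.val q.val ω ∧ Mono true q.val (m + 1) ω)) ∧
      (RdS (cycleHost m) (fun _ => EStat.free) ω 0 q ↔
        (Mono true 0 p.val ω ∧ Mono true p.val q.val ω) ∨ Mono true q.val (m + 1) ω) ∧
      (RdS (cycleHost m) (fun _ => EStat.free) ω p q ↔
        Mono true p.val q.val ω ∨ (Mono true 0 p.val ω ∧ Mono true q.val (m + 1) ω)) ∧
      (MgS (cycleHost m) (fun _ => EStat.free) ω 0 p ↔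
        Mono false 0 p.val ω ∨ (Mono false p.val q.val ω ∧ Mono false q.val (m + 1) ω)) ∧
      (MgS (cycleHost m) (fun _ => EStat.free) ω 0 q ↔
        (Mono false 0 p.val ω ∧ Mono false p.val q.val ω) ∨ Mono false q.val (m + 1) ω) ∧
      (MgS (cycleHost m) (fun _ => EStat.free) ω p q ↔
        Mono false p.val q.val ω ∨ (Mono false 0 p.val ω ∧ Mono false q.val (m + 1) ω)) := by
  have h0p : (0 : Fin (m + 1)).val < p.val := by simpa using hp
  have h0q : (0 : Fin (m + 1)).val < q.val := by simp; omega
  have hq : q.val ≤ m + 1 := le_of_lt q.isLt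
  refine ⟨?_, ?_, ?_, ?_, ?_, ?_⟩
  · rw [RdS_cycle_iff ω h0p, Fin.val_zero, mono_split true ω (le_of_lt hpq) hq]
    simp only [mono_empty, true_and]
  · rw [RdS_cycle_iff ω h0q, Fin.val_zero, mono_split true ω (le_of_lt hp) (le_of_lt hpq)]
    simp only [mono_empty, true_and]
  · rw [RdS_cycle_iff ω hpq]
  · rw [MgS_cycle_iff ω h0p, Fin.val_zero, mono_split false ω (le_of_lt hpq) hq]
    simp only [mono_empty, true_and]
  · rw [MgS_cycle_iff ω h0q, Fin.val_zero, mono_split false ω (le_of_lt hp) (le_of_lt hpq)]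
    simp only [mono_empty, true_and]
  · rw [MgS_cycle_iff ω hpq]

include hp hpq in
/-- The crossed classes of the cycle are the three «one arc red, one arc blue, one arc mixed» classes. -/
theorem cycCrossed_cycle_iff (ω : Fin (m + 1) → Bool) :
    CycCrossed (cycleHost m) 0 p q ω ↔ arcA p q ω ∨ arcB p q ω ∨ arcC p q ω := by
  rw [← cycCrossedS_free, cycCrossedS_iff]
  obtain ⟨h1, h2, h3, h4, h5, h6⟩ := cycle_atoms p q hp hpq ω
  rw [h1, h2, h3, h4, h5, h6]
  unfold arcA arcB arcC
  have na : ¬ (Mono true 0 p.val ω ∧ Mono false 0 p.val ω) := fun h =>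
    not_mono_both ω hp (by omega) h.1 h.2
  have nb : ¬ (Mono true p.val q.val ω ∧ Mono false p.val q.val ω) := fun h =>
    not_mono_both ω hpq (le_of_lt q.isLt) h.1 h.2
  have nc : ¬ (Mono true q.val (m + 1) ω ∧ Mono false q.val (m + 1) ω) := fun h =>
    not_mono_both ω q.isLt le_rfl h.1 h.2
  rcases Classical.em (Mono true 0 p.val ω) with ha | ha <;>
    rcases Classical.em (Mono true p.val q.val ω) with hb | hb <;>
    rcases Classical.em (Mono true q.val (m + 1) ω) with hc | hc <;>
    rcases Classical.em (Mono false 0 p.val ω) with ha' | ha' <;>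
    rcases Classical.em (Mono false p.val q.val ω) with hb' | hb' <;>
    rcases Classical.em (Mono false q.val (m + 1) ω) with hc' | hc' <;>
    simp_all

include hp hpq in
/-- `(⊤, ⊥)` on the cycle: two arcs red, the third not all blue. -/
theorem topBot_cycle_iff (ω : Fin (m + 1) → Bool) :
    TopBot (cycleHost m) 0 p q ω ↔ topArcs p q ω := by
  rw [← topBotS_free, topBotS_iff]
  obtain ⟨h1, h2, h3, h4, h5, h6⟩ := cycle_atoms p q hp hpq ω
  rw [h1, h2, h3, h4, h5, h6]
  unfold topArcs
  have na : ¬ (Mono true 0 p.val ω ∧ Mono false 0 p.val ω) := fun h =>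
    not_mono_both ω hp (by omega) h.1 h.2
  have nb : ¬ (Mono true p.val q.val ω ∧ Mono false p.val q.val ω) := fun h =>
    not_mono_both ω hpq (le_of_lt q.isLt) h.1 h.2
  have nc : ¬ (Mono true q.val (m + 1) ω ∧ Mono false q.val (m + 1) ω) := fun h =>
    not_mono_both ω q.isLt le_rfl h.1 h.2
  rcases Classical.em (Mono true 0 p.val ω) with ha | ha <;>
    rcases Classical.em (Mono true p.val q.val ω) with hb | hb <;>
    rcases Classical.em (Mono true q.val (m + 1) ω) with hc | hc <;>
    rcases Classical.em (Mono false 0 p.val ω) with ha' | ha' <;>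
    rcases Classical.em (Mono false p.val q.val ω) with hb' | hb' <;>
    rcases Classical.em (Mono false q.val (m + 1) ω) with hc' | hc' <;>
    simp_all

/-! ## The arc flip -/

/-- Turn every edge with index in `[lo, hi)` red. -/
def flipArc (lo hi : ℕ) (ω : Fin (m + 1) → Bool) : Fin (m + 1) → Bool := fun i =>
  if lo ≤ i.val ∧ i.val < hi then true else ω i

/-- The flipped arc is red. -/
theorem mono_flipArc (lo hi : ℕ) (ω : Fin (m + 1) → Bool) : Mono true lo hi (flipArc lo hi ω) := by
  intro i h1 h2
  simp [flipArc, h1, h2]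

/-- A range disjoint from the flipped arc is unchanged. -/
theorem mono_flipArc_of_disjoint (c : Bool) (lo hi lo' hi' : ℕ) (ω : Fin (m + 1) → Bool)
    (hd : hi' ≤ lo ∨ hi ≤ lo') : Mono c lo' hi' (flipArc lo hi ω) ↔ Mono c lo' hi' ω := by
  unfold Mono
  refine forall_congr' fun i => forall_congr' fun h1 => forall_congr' fun h2 => ?_
  have : ¬ (lo ≤ i.val ∧ i.val < hi) := by omega
  simp [flipArc, this]

/-- The arc flip is red-ward. -/
theorem leCol_flipArc (lo hi : ℕ) (ω : Fin (m + 1) → Bool) : LeCol ω (flipArc lo hi ω) := by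
  intro e he
  unfold flipArc
  split_ifs <;> simp [he]

/-- Two colourings that are blue on an arc and have the same flip are equal. -/
theorem flipArc_inj (lo hi : ℕ) {ω₁ ω₂ : Fin (m + 1) → Bool} (h₁ : Mono false lo hi ω₁)
    (h₂ : Mono false lo hi ω₂) (h : flipArc lo hi ω₁ = flipArc lo hi ω₂) : ω₁ = ω₂ := by
  funext i
  have hfi := congrFun h i
  unfold flipArc at hfi
  by_cases hin : lo ≤ i.val ∧ i.val < hi
  · rw [h₁ i hin.1 hin.2, h₂ i hin.1 hin.2]
  · rw [if_neg hin, if_neg hin] at hfi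
    exact hfi

open Classical in
/-- **THE ARC FLIP**: the all-blue arc of a crossed colouring is turned red. -/
noncomputable def cycleFlip (ω : Fin (m + 1) → Bool) : Fin (m + 1) → Bool :=
  if arcA p q ω then flipArc q.val (m + 1) ω
  else if arcB p q ω then flipArc p.val q.val ω
  else if arcC p q ω then flipArc 0 p.val ω
  else ω

include hpq in
/-- The arc flip of a crossed colouring lies in `(⊤, ⊥)`. -/
theorem topArcs_cycleFlip (ω : Fin (m + 1) → Bool) (h : arcA p q ω ∨ arcB p q ω ∨ arcC p q ω) :
    topArcs p q (cycleFlip p q ω) := by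
  have hq : q.val ≤ m + 1 := le_of_lt q.isLt
  unfold cycleFlip
  rcases h with hA | hB | hC
  · rw [if_pos hA]
    obtain ⟨ha, _, _, hb'⟩ := hA
    refine Or.inr (Or.inl ⟨?_, mono_flipArc _ _ ω, ?_⟩)
    · rwa [mono_flipArc_of_disjoint _ _ _ _ _ ω (Or.inl (le_of_lt hpq))]
    · rwa [mono_flipArc_of_disjoint _ _ _ _ _ ω (Or.inl le_rfl)]
  · have hnA : ¬ arcA p q ω := fun hA => hB.2.2.1 hA.1
    rw [if_neg hnA, if_pos hB]
    obtain ⟨hc, _, _, ha'⟩ := hB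
    refine Or.inr (Or.inr ⟨mono_flipArc _ _ ω, ?_, ?_⟩)
    · rwa [mono_flipArc_of_disjoint _ _ _ _ _ ω (Or.inr le_rfl)]
    · rwa [mono_flipArc_of_disjoint _ _ _ _ _ ω (Or.inl le_rfl)]
  · have hnA : ¬ arcA p q ω := fun hA => hA.2.2.1 hC.1
    have hnB : ¬ arcB p q ω := fun hB => hC.2.2.1 hB.1
    rw [if_neg hnA, if_neg hnB, if_pos hC]
    obtain ⟨hb, _, _, hc'⟩ := hC
    refine Or.inl ⟨mono_flipArc _ _ ω, ?_, ?_⟩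
    · rwa [mono_flipArc_of_disjoint _ _ _ _ _ ω (Or.inr le_rfl)]
    · rwa [mono_flipArc_of_disjoint _ _ _ _ _ ω (Or.inr (le_of_lt hpq))]

/-- The arc flip is red-ward. -/
theorem leCol_cycleFlip (ω : Fin (m + 1) → Bool) : LeCol ω (cycleFlip p q ω) := by
  unfold cycleFlip
  split_ifs
  · exact leCol_flipArc _ _ ω
  · exact leCol_flipArc _ _ ω
  · exact leCol_flipArc _ _ ω
  · exact LeCol.refl ω

include hpq in
/-- The arc flip is injective on the crossed classes: within a class the flipped arc was blue, across classes
the images keep different arcs mixed. -/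
theorem cycleFlip_injOn :
    Set.InjOn (cycleFlip p q) {ω | arcA p q ω ∨ arcB p q ω ∨ arcC p q ω} := by
  intro ω₁ h₁ ω₂ h₂ heq
  simp only [Set.mem_setOf_eq] at h₁ h₂
  have hq : q.val ≤ m + 1 := le_of_lt q.isLt
  -- the image of each class, and the arc it keeps mixed
  have keyA : ∀ ω, arcA p q ω → cycleFlip p q ω = flipArc q.val (m + 1) ω ∧
      ¬ Mono true p.val q.val (cycleFlip p q ω) := by
    intro ω hA
    have : cycleFlip p q ω = flipArc q.val (m + 1) ω := by unfold cycleFlip; rw [if_pos hA]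
    refine ⟨this, ?_⟩
    rw [this, mono_flipArc_of_disjoint _ _ _ _ _ ω (Or.inl le_rfl)]
    exact hA.2.2.1
  have keyB : ∀ ω, arcB p q ω → cycleFlip p q ω = flipArc p.val q.val ω ∧
      ¬ Mono true 0 p.val (cycleFlip p q ω) := by
    intro ω hB
    have hnA : ¬ arcA p q ω := fun hA => hB.2.2.1 hA.1
    have : cycleFlip p q ω = flipArc p.val q.val ω := by unfold cycleFlip; rw [if_neg hnA, if_pos hB]
    refine ⟨this, ?_⟩
    rw [this, mono_flipArc_of_disjoint _ _ _ _ _ ω (Or.inl le_rfl)]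
    exact hB.2.2.1
  have keyC : ∀ ω, arcC p q ω → cycleFlip p q ω = flipArc 0 p.val ω ∧
      ¬ Mono true q.val (m + 1) (cycleFlip p q ω) := by
    intro ω hC
    have hnA : ¬ arcA p q ω := fun hA => hA.2.2.1 hC.1
    have hnB : ¬ arcB p q ω := fun hB => hC.2.2.1 hB.1
    have : cycleFlip p q ω = flipArc 0 p.val ω := by unfold cycleFlip; rw [if_neg hnA, if_neg hnB, if_pos hC]
    refine ⟨this, ?_⟩
    rw [this, mono_flipArc_of_disjoint _ _ _ _ _ ω (Or.inr (le_of_lt hpq))]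
    exact hC.2.2.1
  -- the image of a class has its two other arcs red
  have redA : ∀ ω, arcA p q ω → Mono true q.val (m + 1) (cycleFlip p q ω) ∧ Mono true 0 p.val (cycleFlip p q ω) := by
    intro ω hA
    rw [(keyA ω hA).1]
    exact ⟨mono_flipArc _ _ ω, by
      rw [mono_flipArc_of_disjoint _ _ _ _ _ ω (Or.inl (le_of_lt hpq))]
      exact hA.1⟩
  have redB : ∀ ω, arcB p q ω → Mono true p.val q.val (cycleFlip p q ω) ∧ Mono true q.val (m + 1) (cycleFlip p q ω) := by
    intro ω hB
    rw [(keyB ω hB).1]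
    exact ⟨mono_flipArc _ _ ω, by
      rw [mono_flipArc_of_disjoint _ _ _ _ _ ω (Or.inr le_rfl)]
      exact hB.1⟩
  have redC : ∀ ω, arcC p q ω → Mono true 0 p.val (cycleFlip p q ω) ∧ Mono true p.val q.val (cycleFlip p q ω) := by
    intro ω hC
    rw [(keyC ω hC).1]
    exact ⟨mono_flipArc _ _ ω, by
      rw [mono_flipArc_of_disjoint _ _ _ _ _ ω (Or.inr le_rfl)]
      exact hC.1⟩
  rcases h₁ with hA₁ | hB₁ | hC₁ <;> rcases h₂ with hA₂ | hB₂ | hC₂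
  · rw [(keyA ω₁ hA₁).1, (keyA ω₂ hA₂).1] at heq
    exact flipArc_inj _ _ hA₁.2.1 hA₂.2.1 heq
  · exact absurd (heq ▸ (redB ω₂ hB₂).1) (keyA ω₁ hA₁).2
  · exact absurd (heq ▸ (redC ω₂ hC₂).2) (keyA ω₁ hA₁).2
  · exact absurd (heq ▸ (redA ω₂ hA₂).2) (keyB ω₁ hB₁).2
  · rw [(keyB ω₁ hB₁).1, (keyB ω₂ hB₂).1] at heq
    exact flipArc_inj _ _ hB₁.2.1 hB₂.2.1 heq
  · exact absurd (heq ▸ (redC ω₂ hC₂).1) (keyB ω₁ hB₁).2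
  · exact absurd (heq ▸ (redA ω₂ hA₂).1) (keyC ω₁ hC₁).2
  · exact absurd (heq ▸ (redB ω₂ hB₂).2) (keyC ω₁ hC₁).2
  · rw [(keyC ω₁ hC₁).1, (keyC ω₂ hC₂).1] at heq
    exact flipArc_inj _ _ hC₁.2.1 hC₂.2.1 heq

include hp hpq in
/-- **THEOREM (CYCLES)**: CONJECTURE (STOCHASTIC DOMINATION) holds on every cycle host with the three marks on
the cycle. -/
theorem cycDomination_cycle : CycDomination (cycleHost m) 0 p q := by
  rw [cycDomination_iff_injection]
  refine ⟨cycleFlip p q, ?_, fun ω hω => ?_⟩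
  · have h := cycleFlip_injOn p q hpq
    intro ω₁ h₁ ω₂ h₂ heq
    exact h (by simpa [cycCrossed_cycle_iff p q hp hpq] using h₁)
      (by simpa [cycCrossed_cycle_iff p q hp hpq] using h₂) heq
  · rw [cycCrossed_cycle_iff p q hp hpq] at hω
    exact ⟨(topBot_cycle_iff p q hp hpq _).mpr (topArcs_cycleFlip p q hpq ω hω), leCol_cycleFlip p q ω⟩

end MultiExit

end ZoneZ

end PercRepro
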